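import Mathlib
import Summits.NavierStokesRegularity.NavierStokesRegularity.Theorems.SlicedKelvinFoldLawEpsPlane
import Summits.NavierStokesRegularity.NavierStokesRegularity.Theorems.SlicedKelvinFoldLawEpsPointwise
import Summits.NavierStokesRegularity.NavierStokesRegularity.Theses.SlicedKelvin
import HarnessLib

/-!
# `SlicedKelvin.FoldLawEps` — the ε-regularised fold law on a coordinate plane (item
  stmt-NavierStokesRegularity-15606, part 3 of 3)

**Statement.** For any real `ν`, `ε > 0`, `c`, and a smooth rapidly decaying divergence-free `u`
on `ℝ³`, with `ω = curl u`, `f = ω₂`, `F(s) = √(s² + ε²)`, `w = νΔω − curl (ω × u)` and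
`Π = {x₂ = c}` (integrals over `y ∈ ℝ²`, `P y = (y₀, y₁, c)`):
`∫_Π F'(f) w₂ = ν∫_Π ∂₂²(F∘f) − ν∫_Π F''(f)|∇f|² − ∫_Π u₂ F''(f)(ω₀∂₀f + ω₁∂₁f) − ε²∫_Π ∂₂u₂/F(f)`,
`F' = s/F`, `F'' = ε²/F³`.

PROOF (a kinematic identity; six in-plane integrations by parts). In coordinates
`(Δω)₂ = Σⱼ∂ⱼ∂ⱼf` and `(curl(ω × u))₂ = ∂₀(f u₀ − ω₀u₂) − ∂₁(ω₁u₂ − f u₁)`. Over the plane, for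
`i = 0, 1` (`FoldLaw.ibp_plane`):
(A) `∫ F'(f)∂ᵢ∂ᵢf = −∫ F''(f)(∂ᵢf)²`, and `F'(f)∂₂∂₂f = ∂₂²(F∘f) − F''(f)(∂₂f)²` pointwise;
(B) `∫ uᵢ ∂ᵢ(F∘f) = −∫ ∂ᵢuᵢ F(f)`, so with `∂₀u₀ + ∂₁u₁ = −∂₂u₂`:
    `−Σᵢ∫F'(f)∂ᵢ(f uᵢ) = ∫ ∂₂u₂ (f F'(f) − F(f)) = −ε² ∫ ∂₂u₂/F(f)`;
(C) `∫ F'(f)∂ᵢ(ωᵢu₂) = −∫ F''(f)∂ᵢf ωᵢ u₂` — transport and stretching cancel against each other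
except for this term. Every integrand is (bounded) × (cubically decaying) restricted to the plane,
hence integrable (`FoldLaw.integrable_plane_mul`).

HONEST FRAMING: a calculus identity for HYPOTHETICAL smooth fields; no Navier–Stokes solution is
involved and nothing here bears on the regularity problem itself.
-/

noncomputable section

set_option linter.dupNamespace false

namespace Summit.NavierStokesRegularity.NavierStokesRegularity.Theorems

open MeasureTheory Set Filter Topology Metric Function Literature.Analysis.FluidPDE
open scoped NNReal ENNReal ContDiff Laplacian

namespace FoldLaw

variable {ε : ℝ} {u : EuclideanSpace ℝ (Fin 3) → EuclideanSpace ℝ (Fin 3)}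

/-! ### Atoms for the modulus composed with `f = ω₂` -/

/-- Smoothness, bounds and in-plane derivatives of `F∘f`, `F'∘f`, `F''∘f` for `f = (curl u)₂`.
[folklore] -/
theorem modulus_atoms (hε : 0 < ε) (hu : ContDiff ℝ ∞ u) :
    ContDiff ℝ ∞ (fun x => Real.sqrt ((curl u x 2) ^ 2 + ε ^ 2)) ∧
    ContDiff ℝ ∞ (fun x => curl u x 2 / Real.sqrt ((curl u x 2) ^ 2 + ε ^ 2)) ∧
    Continuous (fun x => ε ^ 2 / Real.sqrt ((curl u x 2) ^ 2 + ε ^ 2) ^ 3) ∧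
    (∀ x, |curl u x 2 / Real.sqrt ((curl u x 2) ^ 2 + ε ^ 2)| ≤ 1) ∧
    (∀ x, |ε ^ 2 / Real.sqrt ((curl u x 2) ^ 2 + ε ^ 2) ^ 3| ≤ 1 / ε) ∧
    (∀ i x, pderiv i (fun x => Real.sqrt ((curl u x 2) ^ 2 + ε ^ 2)) x =
      curl u x 2 / Real.sqrt ((curl u x 2) ^ 2 + ε ^ 2) * pderiv i (fun x => curl u x 2) x) ∧
    (∀ i x, pderiv i (fun x => curl u x 2 / Real.sqrt ((curl u x 2) ^ 2 + ε ^ 2)) x =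
      ε ^ 2 / Real.sqrt ((curl u x 2) ^ 2 + ε ^ 2) ^ 3 * pderiv i (fun x => curl u x 2) x) := by
  obtain ⟨-, hω, -, -, -⟩ := smooth_atoms hu
  have hf : ContDiff ℝ ∞ fun x => curl u x 2 := hω 2
  have hfd : Differentiable ℝ fun x => curl u x 2 := hf.differentiable (by simp)
  exact ⟨(contDiff_F hε).comp hf, (contDiff_Fprime hε).comp hf,
    (continuous_Fsecond hε).comp hf.continuous, fun x => PassiveScalarL1.abs_katoDeriv_le hε _,
    fun x => abs_Fsecond_le hε _, fun i x => pderiv_scalar_comp (hasDerivAt_F hε _) (hfd x) i,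
    fun i x => pderiv_scalar_comp (hasDerivAt_Fprime hε _) (hfd x) i⟩

/-- `|F(f x)| ≤ K + ε` when `|f| ≤ K (1 + ‖x‖)⁻³`. [folklore] -/
theorem abs_F_comp_le (hε : 0 < ε) {K : ℝ} (hK : ∀ x, |curl u x 2| ≤ K / (1 + ‖x‖) ^ 3)
    (x : EuclideanSpace ℝ (Fin 3)) : |Real.sqrt ((curl u x 2) ^ 2 + ε ^ 2)| ≤ K + ε := by
  rw [abs_of_pos (PassiveScalarL1.sqrt_sq_add_sq_pos hε _)]
  linarith [abs_le_of_decay hK x, PassiveScalarL1.sqrt_sq_add_sq_le hε.le (curl u x 2)]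

/-! ### The three in-plane integrations by parts -/

/-- **(A)** `∫_Π F'(f) ∂ᵢ∂ᵢf = −∫_Π F''(f) (∂ᵢf)²`, `i = 0, 1`. [folklore] -/
theorem ibp_A (hε : 0 < ε) (hu : ContDiff ℝ ∞ u) (hdec : HasRapidSpatialDecay u) (c : ℝ) (i : Fin 2) :
    ∫ y : EuclideanSpace ℝ (Fin 2),
        curl u (WithLp.toLp 2 ![y 0, y 1, c]) 2 /
            Real.sqrt ((curl u (WithLp.toLp 2 ![y 0, y 1, c]) 2) ^ 2 + ε ^ 2) *
          pderiv (Fin.castSucc i) (pderiv (Fin.castSucc i) fun x => curl u x 2) (WithLp.toLp 2 ![y 0, y 1, c]) =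
      - ∫ y : EuclideanSpace ℝ (Fin 2),
        ε ^ 2 / Real.sqrt ((curl u (WithLp.toLp 2 ![y 0, y 1, c]) 2) ^ 2 + ε ^ 2) ^ 3 *
            pderiv (Fin.castSucc i) (fun x => curl u x 2) (WithLp.toLp 2 ![y 0, y 1, c]) *
          pderiv (Fin.castSucc i) (fun x => curl u x 2) (WithLp.toLp 2 ![y 0, y 1, c]) := by
  obtain ⟨K, -, -, hw, hpw, hppw⟩ := decay_atoms hu hdec
  obtain ⟨-, hω, -, hpω, -⟩ := smooth_atoms hu
  obtain ⟨-, hF', -, bF', bF'', -, dF'⟩ := modulus_atoms hε hu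
  have hpa : pderiv (Fin.castSucc i) (fun x => curl u x 2 / Real.sqrt ((curl u x 2) ^ 2 + ε ^ 2)) =
      fun x => ε ^ 2 / Real.sqrt ((curl u x 2) ^ 2 + ε ^ 2) ^ 3 *
        pderiv (Fin.castSucc i) (fun x => curl u x 2) x := funext (dF' _)
  exact ibp_plane c hF' (hpω _ 2) i hpa rfl bF' (abs_le_of_decay (hpw _ 2))
    (abs_mul_le_decay bF'' (hpw _ 2)) (hppw _ 2) (abs_mul_le_decay bF' (hpw _ 2))

/-- **(B)** `∫_Π uᵢ ∂ᵢ(F∘f) = −∫_Π ∂ᵢuᵢ F(f)`, `i = 0, 1`. [folklore] -/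
theorem ibp_B (hε : 0 < ε) (hu : ContDiff ℝ ∞ u) (hdec : HasRapidSpatialDecay u) (c : ℝ) (i : Fin 2) :
    ∫ y : EuclideanSpace ℝ (Fin 2),
        u (WithLp.toLp 2 ![y 0, y 1, c]) (Fin.castSucc i) *
          (curl u (WithLp.toLp 2 ![y 0, y 1, c]) 2 /
              Real.sqrt ((curl u (WithLp.toLp 2 ![y 0, y 1, c]) 2) ^ 2 + ε ^ 2) *
            pderiv (Fin.castSucc i) (fun x => curl u x 2) (WithLp.toLp 2 ![y 0, y 1, c])) =
      - ∫ y : EuclideanSpace ℝ (Fin 2),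
        pderiv (Fin.castSucc i) (fun x => u x (Fin.castSucc i)) (WithLp.toLp 2 ![y 0, y 1, c]) *
          Real.sqrt ((curl u (WithLp.toLp 2 ![y 0, y 1, c]) 2) ^ 2 + ε ^ 2) := by
  obtain ⟨K, hU, hpu, hw, hpw, -⟩ := decay_atoms hu hdec
  obtain ⟨hUs, -, -, -, -⟩ := smooth_atoms hu
  obtain ⟨hF, -, -, bF', -, dF, -⟩ := modulus_atoms hε hu
  have bF := abs_F_comp_le hε (hw 2)
  have hpb : pderiv (Fin.castSucc i) (fun x => Real.sqrt ((curl u x 2) ^ 2 + ε ^ 2)) =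
      fun x => curl u x 2 / Real.sqrt ((curl u x 2) ^ 2 + ε ^ 2) *
        pderiv (Fin.castSucc i) (fun x => curl u x 2) x := funext (dF _)
  exact ibp_plane c (hUs _) hF i rfl hpb (abs_le_of_decay (hU _)) bF (hpu _ _)
    (abs_mul_le_decay bF' (hpw _ 2)) (abs_mul_le_decay' (hU _) bF)

/-- **(C)** `∫_Π F'(f) ∂ᵢ(ωᵢ u₂) = −∫_Π F''(f) ∂ᵢf ωᵢ u₂`, `i = 0, 1`. [folklore] -/
theorem ibp_C (hε : 0 < ε) (hu : ContDiff ℝ ∞ u) (hdec : HasRapidSpatialDecay u) (c : ℝ) (i : Fin 2) :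
    ∫ y : EuclideanSpace ℝ (Fin 2),
        curl u (WithLp.toLp 2 ![y 0, y 1, c]) 2 /
            Real.sqrt ((curl u (WithLp.toLp 2 ![y 0, y 1, c]) 2) ^ 2 + ε ^ 2) *
          pderiv (Fin.castSucc i) (fun x => curl u x (Fin.castSucc i) * u x 2) (WithLp.toLp 2 ![y 0, y 1, c]) =
      - ∫ y : EuclideanSpace ℝ (Fin 2),
        ε ^ 2 / Real.sqrt ((curl u (WithLp.toLp 2 ![y 0, y 1, c]) 2) ^ 2 + ε ^ 2) ^ 3 *
            pderiv (Fin.castSucc i) (fun x => curl u x 2) (WithLp.toLp 2 ![y 0, y 1, c]) *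
          (curl u (WithLp.toLp 2 ![y 0, y 1, c]) (Fin.castSucc i) * u (WithLp.toLp 2 ![y 0, y 1, c]) 2) := by
  obtain ⟨K, hU, hpu, hw, hpw, -⟩ := decay_atoms hu hdec
  obtain ⟨hUs, hω, -, -, -⟩ := smooth_atoms hu
  obtain ⟨-, hF', -, bF', bF'', -, dF'⟩ := modulus_atoms hε hu
  have hpa : pderiv (Fin.castSucc i) (fun x => curl u x 2 / Real.sqrt ((curl u x 2) ^ 2 + ε ^ 2)) =
      fun x => ε ^ 2 / Real.sqrt ((curl u x 2) ^ 2 + ε ^ 2) ^ 3 *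
        pderiv (Fin.castSucc i) (fun x => curl u x 2) x := funext (dF' _)
  have hb : ContDiff ℝ ∞ fun x => curl u x (Fin.castSucc i) * u x 2 := (hω _).mul (hUs 2)
  -- decay of `∂ᵢ(ωᵢ u₂) = ∂ᵢωᵢ u₂ + ωᵢ ∂ᵢu₂`
  have hpb_eq : pderiv (Fin.castSucc i) (fun x => curl u x (Fin.castSucc i) * u x 2) =
      fun x => pderiv (Fin.castSucc i) (fun x => curl u x (Fin.castSucc i)) x * u x 2 +
        curl u x (Fin.castSucc i) * pderiv (Fin.castSucc i) (fun x => u x 2) x :=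
    pderiv_mul ((hω _).differentiable (by simp)) ((hUs 2).differentiable (by simp)) _
  have h₂ : ∀ x, |pderiv (Fin.castSucc i) (fun x => curl u x (Fin.castSucc i) * u x 2) x| ≤
      (K * K + K * K) / (1 + ‖x‖) ^ 3 := by
    intro x
    rw [hpb_eq]
    exact abs_add_le_decay (abs_mul_le_decay' (hpw _ _) (abs_le_of_decay (hU 2)))
      (abs_mul_le_decay (abs_le_of_decay (hw _)) (hpu _ 2)) x
  exact ibp_plane c hF' hb i hpa rfl bF' (abs_mul_le_bdd (abs_le_of_decay (hw _)) (abs_le_of_decay (hU 2)))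
    (abs_mul_le_decay bF'' (hpw _ 2)) h₂
    (abs_mul_le_decay bF' (abs_mul_le_decay' (hw _) (abs_le_of_decay (hU 2))))

/-! ### Pointwise forms of the integrands -/

/-- **The left-hand integrand in coordinates**: `F'(f) w₂` expanded with `(Δω)₂ = Σⱼ∂ⱼ∂ⱼf`,
`(curl(ω × u))₂ = ∂₀(f u₀ − ω₀u₂) − ∂₁(ω₁u₂ − f u₁)` and Leibniz on `∂ᵢ(f uᵢ)`. [folklore] -/
theorem lhs_pointwise (ν : ℝ) (hu : ContDiff ℝ ∞ u) (x : EuclideanSpace ℝ (Fin 3)) :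
    curl u x 2 / Real.sqrt ((curl u x 2) ^ 2 + ε ^ 2) *
        (ν • (Δ (curl u)) x - curl (fun z => cross (curl u z) (u z)) x) 2 =
      ν * (curl u x 2 / Real.sqrt ((curl u x 2) ^ 2 + ε ^ 2) * pderiv 0 (pderiv 0 fun y => curl u y 2) x) +
      ν * (curl u x 2 / Real.sqrt ((curl u x 2) ^ 2 + ε ^ 2) * pderiv 1 (pderiv 1 fun y => curl u y 2) x) +
      ν * (curl u x 2 / Real.sqrt ((curl u x 2) ^ 2 + ε ^ 2) * pderiv 2 (pderiv 2 fun y => curl u y 2) x) -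
      u x 0 * (curl u x 2 / Real.sqrt ((curl u x 2) ^ 2 + ε ^ 2) * pderiv 0 (fun y => curl u y 2) x) -
      curl u x 2 / Real.sqrt ((curl u x 2) ^ 2 + ε ^ 2) * curl u x 2 * pderiv 0 (fun y => u y 0) x -
      u x 1 * (curl u x 2 / Real.sqrt ((curl u x 2) ^ 2 + ε ^ 2) * pderiv 1 (fun y => curl u y 2) x) -
      curl u x 2 / Real.sqrt ((curl u x 2) ^ 2 + ε ^ 2) * curl u x 2 * pderiv 1 (fun y => u y 1) x +
      curl u x 2 / Real.sqrt ((curl u x 2) ^ 2 + ε ^ 2) * pderiv 0 (fun y => curl u y 0 * u y 2) x +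
      curl u x 2 / Real.sqrt ((curl u x 2) ^ 2 + ε ^ 2) * pderiv 1 (fun y => curl u y 1 * u y 2) x := by
  obtain ⟨hUs, hω, -, -, -⟩ := smooth_atoms hu
  have hdU : ∀ j, Differentiable ℝ fun y => u y j := fun j => (hUs j).differentiable (by simp)
  have hdω : ∀ j, Differentiable ℝ fun y => curl u y j := fun j => (hω j).differentiable (by simp)
  have hd1 : Differentiable ℝ fun z => curl u z 2 * u z 0 := (hdω 2).mul (hdU 0)
  have hd2 : Differentiable ℝ fun z => curl u z 0 * u z 2 := (hdω 0).mul (hdU 2)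
  have hd3 : Differentiable ℝ fun z => curl u z 1 * u z 2 := (hdω 1).mul (hdU 2)
  have hd4 : Differentiable ℝ fun z => curl u z 2 * u z 1 := (hdω 2).mul (hdU 1)
  rw [PiLp.sub_apply, PiLp.smul_apply, smul_eq_mul, laplacian_curl_apply_two hu, curl_cross_apply_two hu,
    pderiv_sub hd1 hd2, pderiv_sub hd3 hd4, pderiv_mul (hdω 2) (hdU 0), pderiv_mul (hdω 2) (hdU 1)]
  ring

/-- `∂₂∂₂(F∘f) = F''(f)(∂₂f)² + F'(f)∂₂∂₂f`. [folklore] -/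
theorem pderiv_pderiv_F_comp (hε : 0 < ε) (hu : ContDiff ℝ ∞ u) (x : EuclideanSpace ℝ (Fin 3)) :
    pderiv 2 (pderiv 2 fun y => Real.sqrt ((curl u y 2) ^ 2 + ε ^ 2)) x =
      ε ^ 2 / Real.sqrt ((curl u x 2) ^ 2 + ε ^ 2) ^ 3 * pderiv 2 (fun y => curl u y 2) x *
          pderiv 2 (fun y => curl u y 2) x +
        curl u x 2 / Real.sqrt ((curl u x 2) ^ 2 + ε ^ 2) * pderiv 2 (pderiv 2 fun y => curl u y 2) x := by
  obtain ⟨-, hω, -, hpω, -⟩ := smooth_atoms hu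
  obtain ⟨-, hF', -, -, -, dF, dF'⟩ := modulus_atoms hε hu
  have e1 : pderiv 2 (fun y => Real.sqrt ((curl u y 2) ^ 2 + ε ^ 2)) =
      fun y => curl u y 2 / Real.sqrt ((curl u y 2) ^ 2 + ε ^ 2) * pderiv 2 (fun y => curl u y 2) y :=
    funext (dF 2)
  rw [e1, pderiv_mul (hF'.differentiable (by simp)) ((hpω 2 2).differentiable (by simp))]
  simp only []
  rw [dF' 2 x]


/-! ### Assembly -/

/-- Decay of `∂ᵢ(ωᵢ u₂)` (Leibniz). [folklore] -/
theorem decay_pderiv_omega_mul (hu : ContDiff ℝ ∞ u) {K : ℝ}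
    (hU : ∀ j x, |u x j| ≤ K / (1 + ‖x‖) ^ 3)
    (hpu : ∀ i j x, |pderiv i (fun y => u y j) x| ≤ K / (1 + ‖x‖) ^ 3)
    (hw : ∀ j x, |curl u x j| ≤ K / (1 + ‖x‖) ^ 3)
    (hpw : ∀ i j x, |pderiv i (fun y => curl u y j) x| ≤ K / (1 + ‖x‖) ^ 3) (i : Fin 3) :
    ∀ x, |pderiv i (fun x => curl u x i * u x 2) x| ≤ (K * K + K * K) / (1 + ‖x‖) ^ 3 := by
  obtain ⟨hUs, hω, -, -, -⟩ := smooth_atoms hu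
  have hpb_eq : pderiv i (fun x => curl u x i * u x 2) =
      fun x => pderiv i (fun x => curl u x i) x * u x 2 + curl u x i * pderiv i (fun x => u x 2) x :=
    pderiv_mul ((hω _).differentiable (by simp)) ((hUs 2).differentiable (by simp)) _
  intro x
  rw [hpb_eq]
  exact abs_add_le_decay (abs_mul_le_decay' (hpw _ _) (abs_le_of_decay (hU 2)))
    (abs_mul_le_decay (abs_le_of_decay (hw _)) (hpu _ 2)) x

/-- **The fold law in coordinates** (the item's identity with `D g i x = ∂ᵢ g (x)` written as
`pderiv`). [folklore] -/
theorem foldLaw_identity (ν c : ℝ) (hε : 0 < ε) (hu : ContDiff ℝ ∞ u) (hdec : HasRapidSpatialDecay u)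
    (hdiv : VectorCalculus.IsDivFree u) :
    (∫ y : EuclideanSpace ℝ (Fin 2), curl u (WithLp.toLp 2 ![y 0, y 1, c]) 2 / Real.sqrt ((curl u (WithLp.toLp 2 ![y 0, y 1, c]) 2) ^ 2 + ε ^ 2) * (ν • (Δ (curl u)) (WithLp.toLp 2 ![y 0, y 1, c]) - curl (fun z => cross (curl u z) (u z)) (WithLp.toLp 2 ![y 0, y 1, c])) 2) =
      ν * (∫ y : EuclideanSpace ℝ (Fin 2), pderiv 2 (pderiv 2 fun x => Real.sqrt ((curl u x 2) ^ 2 + ε ^ 2)) (WithLp.toLp 2 ![y 0, y 1, c])) -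
      ν * (∫ y : EuclideanSpace ℝ (Fin 2), ε ^ 2 / Real.sqrt ((curl u (WithLp.toLp 2 ![y 0, y 1, c]) 2) ^ 2 + ε ^ 2) ^ 3 * (pderiv 0 (fun x => curl u x 2) (WithLp.toLp 2 ![y 0, y 1, c]) ^ 2 + pderiv 1 (fun x => curl u x 2) (WithLp.toLp 2 ![y 0, y 1, c]) ^ 2 + pderiv 2 (fun x => curl u x 2) (WithLp.toLp 2 ![y 0, y 1, c]) ^ 2)) -
      (∫ y : EuclideanSpace ℝ (Fin 2), u (WithLp.toLp 2 ![y 0, y 1, c]) 2 * (ε ^ 2 / Real.sqrt ((curl u (WithLp.toLp 2 ![y 0, y 1, c]) 2) ^ 2 + ε ^ 2) ^ 3) * (curl u (WithLp.toLp 2 ![y 0, y 1, c]) 0 * pderiv 0 (fun x => curl u x 2) (WithLp.toLp 2 ![y 0, y 1, c]) + curl u (WithLp.toLp 2 ![y 0, y 1, c]) 1 * pderiv 1 (fun x => curl u x 2) (WithLp.toLp 2 ![y 0, y 1, c]))) -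
      ε ^ 2 * (∫ y : EuclideanSpace ℝ (Fin 2), pderiv 2 (fun x => u x 2) (WithLp.toLp 2 ![y 0, y 1, c]) / Real.sqrt ((curl u (WithLp.toLp 2 ![y 0, y 1, c]) 2) ^ 2 + ε ^ 2)) := by
  obtain ⟨K, hU, hpu, hw, hpw, hppw⟩ := decay_atoms hu hdec
  obtain ⟨hUs, hω, hpus, hpω, hppω⟩ := smooth_atoms hu
  obtain ⟨hF, hF', cF'', bF', bF'', dF, dF'⟩ := modulus_atoms hε hu
  have bF := abs_F_comp_le hε (hw 2)
  have cF : Continuous fun x => Real.sqrt ((curl u x 2) ^ 2 + ε ^ 2) := hF.continuous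
  have cF' : Continuous fun x => curl u x 2 / Real.sqrt ((curl u x 2) ^ 2 + ε ^ 2) := hF'.continuous
  have cU : ∀ j, Continuous fun x => u x j := fun j => (hUs j).continuous
  have cω : ∀ j, Continuous fun x => curl u x j := fun j => (hω j).continuous
  have cpu : ∀ i j, Continuous (pderiv i fun x => u x j) := fun i j => (hpus i j).continuous
  have cpω : ∀ i j, Continuous (pderiv i fun x => curl u x j) := fun i j => (hpω i j).continuous
  have cppω : ∀ i j, Continuous (pderiv i (pderiv i fun x => curl u x j)) := fun i j => (hppω i j).continuous
  have hd9 := decay_pderiv_omega_mul hu hU hpu hw hpw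
  -- integrability of every term
  have I2 : ∀ i : Fin 3, Integrable fun y : EuclideanSpace ℝ (Fin 2) =>
      curl u (WithLp.toLp 2 ![y 0, y 1, c]) 2 / Real.sqrt ((curl u (WithLp.toLp 2 ![y 0, y 1, c]) 2) ^ 2 + ε ^ 2) * pderiv i (pderiv i fun y => curl u y 2) (WithLp.toLp 2 ![y 0, y 1, c]) := fun i =>
    integrable_plane_mul c cF' (cppω i 2) bF' (hppw i 2)
  have I3 : ∀ i : Fin 3, Integrable fun y : EuclideanSpace ℝ (Fin 2) =>
      ε ^ 2 / Real.sqrt ((curl u (WithLp.toLp 2 ![y 0, y 1, c]) 2) ^ 2 + ε ^ 2) ^ 3 * pderiv i (fun x => curl u x 2) (WithLp.toLp 2 ![y 0, y 1, c]) * pderiv i (fun x => curl u x 2) (WithLp.toLp 2 ![y 0, y 1, c]) := fun i =>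
    integrable_plane_mul' c (a := pderiv i fun x => curl u x 2)
      (b := fun x => ε ^ 2 / Real.sqrt ((curl u x 2) ^ 2 + ε ^ 2) ^ 3 * pderiv i (fun x => curl u x 2) x)
      (cF''.mul (cpω i 2)) (cpω i 2) (abs_mul_le_decay bF'' (hpw i 2)) (abs_le_of_decay (hpw i 2))
  have I5 : ∀ i : Fin 3, Integrable fun y : EuclideanSpace ℝ (Fin 2) =>
      u (WithLp.toLp 2 ![y 0, y 1, c]) i * (curl u (WithLp.toLp 2 ![y 0, y 1, c]) 2 / Real.sqrt ((curl u (WithLp.toLp 2 ![y 0, y 1, c]) 2) ^ 2 + ε ^ 2) * pderiv i (fun x => curl u x 2) (WithLp.toLp 2 ![y 0, y 1, c])) := fun i =>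
    integrable_plane_mul c (a := fun x => u x i)
      (b := fun x => curl u x 2 / Real.sqrt ((curl u x 2) ^ 2 + ε ^ 2) * pderiv i (fun x => curl u x 2) x)
      (cU i) (cF'.mul (cpω i 2)) (abs_le_of_decay (hU i)) (abs_mul_le_decay bF' (hpw i 2))
  have I14 : ∀ i : Fin 3, Integrable fun y : EuclideanSpace ℝ (Fin 2) =>
      curl u (WithLp.toLp 2 ![y 0, y 1, c]) 2 / Real.sqrt ((curl u (WithLp.toLp 2 ![y 0, y 1, c]) 2) ^ 2 + ε ^ 2) * curl u (WithLp.toLp 2 ![y 0, y 1, c]) 2 * pderiv i (fun x => u x i) (WithLp.toLp 2 ![y 0, y 1, c]) := fun i =>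
    integrable_plane_mul c (a := fun x => curl u x 2 / Real.sqrt ((curl u x 2) ^ 2 + ε ^ 2) * curl u x 2)
      (b := pderiv i fun x => u x i) (cF'.mul (cω 2)) (cpu i i)
      (abs_mul_le_bdd bF' (abs_le_of_decay (hw 2))) (hpu i i)
  have I9 : ∀ i : Fin 3, Integrable fun y : EuclideanSpace ℝ (Fin 2) =>
      curl u (WithLp.toLp 2 ![y 0, y 1, c]) 2 / Real.sqrt ((curl u (WithLp.toLp 2 ![y 0, y 1, c]) 2) ^ 2 + ε ^ 2) * pderiv i (fun x => curl u x i * u x 2) (WithLp.toLp 2 ![y 0, y 1, c]) := fun i =>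
    integrable_plane_mul c (b := pderiv i fun x => curl u x i * u x 2) cF'
      (continuous_pderiv ((hω i).mul (hUs 2)) (by simp) i) bF' (hd9 i)
  have I10 : ∀ i : Fin 3, Integrable fun y : EuclideanSpace ℝ (Fin 2) =>
      ε ^ 2 / Real.sqrt ((curl u (WithLp.toLp 2 ![y 0, y 1, c]) 2) ^ 2 + ε ^ 2) ^ 3 * pderiv i (fun x => curl u x 2) (WithLp.toLp 2 ![y 0, y 1, c]) * (curl u (WithLp.toLp 2 ![y 0, y 1, c]) i * u (WithLp.toLp 2 ![y 0, y 1, c]) 2) := fun i =>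
    integrable_plane_mul' c (a := fun x => curl u x i * u x 2)
      (b := fun x => ε ^ 2 / Real.sqrt ((curl u x 2) ^ 2 + ε ^ 2) ^ 3 * pderiv i (fun x => curl u x 2) x)
      (cF''.mul (cpω i 2)) ((cω i).mul (cU 2)) (abs_mul_le_decay bF'' (hpw i 2))
      (abs_mul_le_bdd (abs_le_of_decay (hw i)) (abs_le_of_decay (hU 2)))
  have I6 : ∀ i : Fin 3, Integrable fun y : EuclideanSpace ℝ (Fin 2) =>
      pderiv i (fun x => u x i) (WithLp.toLp 2 ![y 0, y 1, c]) * Real.sqrt ((curl u (WithLp.toLp 2 ![y 0, y 1, c]) 2) ^ 2 + ε ^ 2) := fun i =>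
    integrable_plane_mul' c (a := fun x => Real.sqrt ((curl u x 2) ^ 2 + ε ^ 2))
      (b := pderiv i fun x => u x i) (cpu i i) cF (hpu i i) bF
  -- (L) the left-hand side as a combination of the basic integrals
  have hL : (∫ y : EuclideanSpace ℝ (Fin 2), curl u (WithLp.toLp 2 ![y 0, y 1, c]) 2 / Real.sqrt ((curl u (WithLp.toLp 2 ![y 0, y 1, c]) 2) ^ 2 + ε ^ 2) * (ν • (Δ (curl u)) (WithLp.toLp 2 ![y 0, y 1, c]) - curl (fun z => cross (curl u z) (u z)) (WithLp.toLp 2 ![y 0, y 1, c])) 2) =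
      ν * (∫ y : EuclideanSpace ℝ (Fin 2), curl u (WithLp.toLp 2 ![y 0, y 1, c]) 2 / Real.sqrt ((curl u (WithLp.toLp 2 ![y 0, y 1, c]) 2) ^ 2 + ε ^ 2) * pderiv 0 (pderiv 0 fun y => curl u y 2) (WithLp.toLp 2 ![y 0, y 1, c])) + ν * (∫ y : EuclideanSpace ℝ (Fin 2), curl u (WithLp.toLp 2 ![y 0, y 1, c]) 2 / Real.sqrt ((curl u (WithLp.toLp 2 ![y 0, y 1, c]) 2) ^ 2 + ε ^ 2) * pderiv 1 (pderiv 1 fun y => curl u y 2) (WithLp.toLp 2 ![y 0, y 1, c])) + ν * (∫ y : EuclideanSpace ℝ (Fin 2), curl u (WithLp.toLp 2 ![y 0, y 1, c]) 2 / Real.sqrt ((curl u (WithLp.toLp 2 ![y 0, y 1, c]) 2) ^ 2 + ε ^ 2) * pderiv 2 (pderiv 2 fun y => curl u y 2) (WithLp.toLp 2 ![y 0, y 1, c])) -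
      (∫ y : EuclideanSpace ℝ (Fin 2), u (WithLp.toLp 2 ![y 0, y 1, c]) 0 * (curl u (WithLp.toLp 2 ![y 0, y 1, c]) 2 / Real.sqrt ((curl u (WithLp.toLp 2 ![y 0, y 1, c]) 2) ^ 2 + ε ^ 2) * pderiv 0 (fun x => curl u x 2) (WithLp.toLp 2 ![y 0, y 1, c]))) - (∫ y : EuclideanSpace ℝ (Fin 2), curl u (WithLp.toLp 2 ![y 0, y 1, c]) 2 / Real.sqrt ((curl u (WithLp.toLp 2 ![y 0, y 1, c]) 2) ^ 2 + ε ^ 2) * curl u (WithLp.toLp 2 ![y 0, y 1, c]) 2 * pderiv 0 (fun x => u x 0) (WithLp.toLp 2 ![y 0, y 1, c])) - (∫ y : EuclideanSpace ℝ (Fin 2), u (WithLp.toLp 2 ![y 0, y 1, c]) 1 * (curl u (WithLp.toLp 2 ![y 0, y 1, c]) 2 / Real.sqrt ((curl u (WithLp.toLp 2 ![y 0, y 1, c]) 2) ^ 2 + ε ^ 2) * pderiv 1 (fun x => curl u x 2) (WithLp.toLp 2 ![y 0, y 1, c]))) - (∫ y : EuclideanSpace ℝ (Fin 2), curl u (WithLp.toLp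 2 ![y 0, y 1, c]) 2 / Real.sqrt ((curl u (WithLp.toLp 2 ![y 0, y 1, c]) 2) ^ 2 + ε ^ 2) * curl u (WithLp.toLp 2 ![y 0, y 1, c]) 2 * pderiv 1 (fun x => u x 1) (WithLp.toLp 2 ![y 0, y 1, c])) +
      (∫ y : EuclideanSpace ℝ (Fin 2), curl u (WithLp.toLp 2 ![y 0, y 1, c]) 2 / Real.sqrt ((curl u (WithLp.toLp 2 ![y 0, y 1, c]) 2) ^ 2 + ε ^ 2) * pderiv 0 (fun x => curl u x 0 * u x 2) (WithLp.toLp 2 ![y 0, y 1, c])) + (∫ y : EuclideanSpace ℝ (Fin 2), curl u (WithLp.toLp 2 ![y 0, y 1, c]) 2 / Real.sqrt ((curl u (WithLp.toLp 2 ![y 0, y 1, c]) 2) ^ 2 + ε ^ 2) * pderiv 1 (fun x => curl u x 1 * u x 2) (WithLp.toLp 2 ![y 0, y 1, c])) := by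
    have H1 := (I2 0).const_mul ν
    have H2 := H1.add ((I2 1).const_mul ν)
    have H3 := H2.add ((I2 2).const_mul ν)
    have H4 := H3.sub (I5 0)
    have H5 := H4.sub (I14 0)
    have H6 := H5.sub (I5 1)
    have H7 := H6.sub (I14 1)
    have H8 := H7.add (I9 0)
    calc (∫ y : EuclideanSpace ℝ (Fin 2), curl u (WithLp.toLp 2 ![y 0, y 1, c]) 2 / Real.sqrt ((curl u (WithLp.toLp 2 ![y 0, y 1, c]) 2) ^ 2 + ε ^ 2) * (ν • (Δ (curl u)) (WithLp.toLp 2 ![y 0, y 1, c]) - curl (fun z => cross (curl u z) (u z)) (WithLp.toLp 2 ![y 0, y 1, c])) 2)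
        = ∫ y : EuclideanSpace ℝ (Fin 2), (ν * (curl u (WithLp.toLp 2 ![y 0, y 1, c]) 2 / Real.sqrt ((curl u (WithLp.toLp 2 ![y 0, y 1, c]) 2) ^ 2 + ε ^ 2) * pderiv 0 (pderiv 0 fun y => curl u y 2) (WithLp.toLp 2 ![y 0, y 1, c])) + ν * (curl u (WithLp.toLp 2 ![y 0, y 1, c]) 2 / Real.sqrt ((curl u (WithLp.toLp 2 ![y 0, y 1, c]) 2) ^ 2 + ε ^ 2) * pderiv 1 (pderiv 1 fun y => curl u y 2) (WithLp.toLp 2 ![y 0, y 1, c])) + ν * (curl u (WithLp.toLp 2 ![y 0, y 1, c]) 2 / Real.sqrt ((curl u (WithLp.toLp 2 ![y 0, y 1, c]) 2) ^ 2 + ε ^ 2) * pderiv 2 (pderiv 2 fun y => curl u y 2) (WithLp.toLp 2 ![y 0, y 1, c])) -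
            u (WithLp.toLp 2 ![y 0, y 1, c]) 0 * (curl u (WithLp.toLp 2 ![y 0, y 1, c]) 2 / Real.sqrt ((curl u (WithLp.toLp 2 ![y 0, y 1, c]) 2) ^ 2 + ε ^ 2) * pderiv 0 (fun x => curl u x 2) (WithLp.toLp 2 ![y 0, y 1, c])) - curl u (WithLp.toLp 2 ![y 0, y 1, c]) 2 / Real.sqrt ((curl u (WithLp.toLp 2 ![y 0, y 1, c]) 2) ^ 2 + ε ^ 2) * curl u (WithLp.toLp 2 ![y 0, y 1, c]) 2 * pderiv 0 (fun x => u x 0) (WithLp.toLp 2 ![y 0, y 1, c]) - u (WithLp.toLp 2 ![y 0, y 1, c]) 1 * (curl u (WithLp.toLp 2 ![y 0, y 1, c]) 2 / Real.sqrt ((curl u (WithLp.toLp 2 ![y 0, y 1, c]) 2) ^ 2 + ε ^ 2) * pderiv 1 (fun x => curl u x 2) (WithLp.toLp 2 ![y 0, y 1, c])) - curl u (WithLp.toLp 2 ![y 0, y 1, c]) 2 / Real.sqrt ((curl u (WithLp.toLp 2 ![y 0, y 1, c]) 2) ^ 2 + ε ^ 2) * curl u (WithLp.toLp 2 ![y 0,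 y 1, c]) 2 * pderiv 1 (fun x => u x 1) (WithLp.toLp 2 ![y 0, y 1, c]) + curl u (WithLp.toLp 2 ![y 0, y 1, c]) 2 / Real.sqrt ((curl u (WithLp.toLp 2 ![y 0, y 1, c]) 2) ^ 2 + ε ^ 2) * pderiv 0 (fun x => curl u x 0 * u x 2) (WithLp.toLp 2 ![y 0, y 1, c]) + curl u (WithLp.toLp 2 ![y 0, y 1, c]) 2 / Real.sqrt ((curl u (WithLp.toLp 2 ![y 0, y 1, c]) 2) ^ 2 + ε ^ 2) * pderiv 1 (fun x => curl u x 1 * u x 2) (WithLp.toLp 2 ![y 0, y 1, c])) := by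
          congr 1; funext y; exact lhs_pointwise ν hu _
      _ = _ := by
          rw [integral_add ?_ (I9 1), integral_add ?_ (I9 0), integral_sub ?_ (I14 1), integral_sub ?_ (I5 1),
            integral_sub ?_ (I14 0), integral_sub ?_ (I5 0), integral_add ?_ ((I2 2).const_mul ν),
            integral_add ?_ ((I2 1).const_mul ν), integral_const_mul, integral_const_mul, integral_const_mul]
          all_goals first | exact H8 | exact H7 | exact H6 | exact H5 | exact H4 | exact H3 | exact H2 | exact H1
  -- (A), (B), (C): the in-plane integrations by parts
  have hA0 := ibp_A hε hu hdec c 0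
  have hA1 := ibp_A hε hu hdec c 1
  have hB0 := ibp_B hε hu hdec c 0
  have hB1 := ibp_B hε hu hdec c 1
  have hC0 := ibp_C hε hu hdec c 0
  have hC1 := ibp_C hε hu hdec c 1
  have e0 : (Fin.castSucc (0 : Fin 2) : Fin 3) = 0 := rfl
  have e1 : (Fin.castSucc (1 : Fin 2) : Fin 3) = 1 := rfl
  simp only [e0, e1] at hA0 hA1 hB0 hB1 hC0 hC1
  -- (T1)–(T3): the right-hand integrands split
  have hT1 : (∫ y : EuclideanSpace ℝ (Fin 2), pderiv 2 (pderiv 2 fun x => Real.sqrt ((curl u x 2) ^ 2 + ε ^ 2)) (WithLp.toLp 2 ![y 0, y 1, c])) = (∫ y : EuclideanSpace ℝ (Fin 2), ε ^ 2 / Real.sqrt ((curl u (WithLp.toLp 2 ![y 0, y 1, c]) 2) ^ 2 + ε ^ 2) ^ 3 * pderiv 2 (fun x => curl u x 2) (WithLp.toLp 2 ![y 0, y 1, c]) * pderiv 2 (fun x => curl u x 2) (WithLp.toLp 2 ![y 0, y 1, c])) + (∫ y : EuclideanSpace ℝ (Fin 2), curl u (WithLp.toLp 2 ![y 0, y 1,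 c]) 2 / Real.sqrt ((curl u (WithLp.toLp 2 ![y 0, y 1, c]) 2) ^ 2 + ε ^ 2) * pderiv 2 (pderiv 2 fun y => curl u y 2) (WithLp.toLp 2 ![y 0, y 1, c])) := by
    calc (∫ y : EuclideanSpace ℝ (Fin 2), pderiv 2 (pderiv 2 fun x => Real.sqrt ((curl u x 2) ^ 2 + ε ^ 2)) (WithLp.toLp 2 ![y 0, y 1, c])) = ∫ y : EuclideanSpace ℝ (Fin 2), (ε ^ 2 / Real.sqrt ((curl u (WithLp.toLp 2 ![y 0, y 1, c]) 2) ^ 2 + ε ^ 2) ^ 3 * pderiv 2 (fun x => curl u x 2) (WithLp.toLp 2 ![y 0, y 1, c]) * pderiv 2 (fun x => curl u x 2) (WithLp.toLp 2 ![y 0, y 1, c]) + curl u (WithLp.toLp 2 ![y 0, y 1, c]) 2 / Real.sqrt ((curl u (WithLp.toLp 2 ![y 0, y 1, c]) 2) ^ 2 + ε ^ 2) * pderiv 2 (pderiv 2 fun y => curl u y 2) (WithLp.toLp 2 ![y 0, y 1, c])) := by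
          congr 1; funext y; exact pderiv_pderiv_F_comp hε hu _
      _ = _ := integral_add (I3 2) (I2 2)
  have hT2 : (∫ y : EuclideanSpace ℝ (Fin 2), ε ^ 2 / Real.sqrt ((curl u (WithLp.toLp 2 ![y 0, y 1, c]) 2) ^ 2 + ε ^ 2) ^ 3 * (pderiv 0 (fun x => curl u x 2) (WithLp.toLp 2 ![y 0, y 1, c]) ^ 2 + pderiv 1 (fun x => curl u x 2) (WithLp.toLp 2 ![y 0, y 1, c]) ^ 2 + pderiv 2 (fun x => curl u x 2) (WithLp.toLp 2 ![y 0, y 1, c]) ^ 2)) = (∫ y : EuclideanSpace ℝ (Fin 2), ε ^ 2 / Real.sqrt ((curl u (WithLp.toLp 2 ![y 0, y 1, c]) 2) ^ 2 + ε ^ 2) ^ 3 * pderiv 0 (fun x => curl u x 2) (WithLp.toLp 2 ![y 0, y 1, c]) * pderiv 0 (fun x => curl u x 2) (WithLp.toLp 2 ![y 0, y 1, c])) + (∫ y : EuclideanSpace ℝ (Fin 2), ε ^ 2 / Real.sqrt ((curl u (WithLp.toLp 2 ![y 0, y 1, c]) 2) ^ 2 + ε ^ 2) ^ 3 * pderiv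 1 (fun x => curl u x 2) (WithLp.toLp 2 ![y 0, y 1, c]) * pderiv 1 (fun x => curl u x 2) (WithLp.toLp 2 ![y 0, y 1, c])) + (∫ y : EuclideanSpace ℝ (Fin 2), ε ^ 2 / Real.sqrt ((curl u (WithLp.toLp 2 ![y 0, y 1, c]) 2) ^ 2 + ε ^ 2) ^ 3 * pderiv 2 (fun x => curl u x 2) (WithLp.toLp 2 ![y 0, y 1, c]) * pderiv 2 (fun x => curl u x 2) (WithLp.toLp 2 ![y 0, y 1, c])) := by
    calc (∫ y : EuclideanSpace ℝ (Fin 2), ε ^ 2 / Real.sqrt ((curl u (WithLp.toLp 2 ![y 0, y 1, c]) 2) ^ 2 + ε ^ 2) ^ 3 * (pderiv 0 (fun x => curl u x 2) (WithLp.toLp 2 ![y 0, y 1, c]) ^ 2 + pderiv 1 (fun x => curl u x 2) (WithLp.toLp 2 ![y 0, y 1, c]) ^ 2 + pderiv 2 (fun x => curl u x 2) (WithLp.toLp 2 ![y 0, y 1, c]) ^ 2)) = ∫ y : EuclideanSpace ℝ (Fin 2), (ε ^ 2 / Real.sqrt ((curl u (WithLp.toLp 2 ![y 0, y 1, c]) 2)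 ^ 2 + ε ^ 2) ^ 3 * pderiv 0 (fun x => curl u x 2) (WithLp.toLp 2 ![y 0, y 1, c]) * pderiv 0 (fun x => curl u x 2) (WithLp.toLp 2 ![y 0, y 1, c]) + ε ^ 2 / Real.sqrt ((curl u (WithLp.toLp 2 ![y 0, y 1, c]) 2) ^ 2 + ε ^ 2) ^ 3 * pderiv 1 (fun x => curl u x 2) (WithLp.toLp 2 ![y 0, y 1, c]) * pderiv 1 (fun x => curl u x 2) (WithLp.toLp 2 ![y 0, y 1, c]) + ε ^ 2 / Real.sqrt ((curl u (WithLp.toLp 2 ![y 0, y 1, c]) 2) ^ 2 + ε ^ 2) ^ 3 * pderiv 2 (fun x => curl u x 2) (WithLp.toLp 2 ![y 0, y 1, c]) * pderiv 2 (fun x => curl u x 2) (WithLp.toLp 2 ![y 0, y 1, c])) := by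
          congr 1; funext y; ring
      _ = _ := by
          rw [integral_add ?_ (I3 2), integral_add (I3 0) (I3 1)]
          exact (I3 0).add (I3 1)
  have hT3 : (∫ y : EuclideanSpace ℝ (Fin 2), u (WithLp.toLp 2 ![y 0, y 1, c]) 2 * (ε ^ 2 / Real.sqrt ((curl u (WithLp.toLp 2 ![y 0, y 1, c]) 2) ^ 2 + ε ^ 2) ^ 3) * (curl u (WithLp.toLp 2 ![y 0, y 1, c]) 0 * pderiv 0 (fun x => curl u x 2) (WithLp.toLp 2 ![y 0, y 1, c]) + curl u (WithLp.toLp 2 ![y 0, y 1, c]) 1 * pderiv 1 (fun x => curl u x 2) (WithLp.toLp 2 ![y 0, y 1, c]))) = (∫ y : EuclideanSpace ℝ (Fin 2), ε ^ 2 / Real.sqrt ((curl u (WithLp.toLp 2 ![y 0, y 1, c]) 2) ^ 2 + ε ^ 2) ^ 3 * pderiv 0 (fun x => curl u x 2) (WithLp.toLp 2 ![y 0, y 1, c]) * (curl u (WithLp.toLp 2 ![y 0, y 1, c]) 0 * u (WithLp.toLp 2 ![y 0, y 1, c]) 2)) + (∫ y : EuclideanSpace ℝ (Fin 2), ε ^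 2 / Real.sqrt ((curl u (WithLp.toLp 2 ![y 0, y 1, c]) 2) ^ 2 + ε ^ 2) ^ 3 * pderiv 1 (fun x => curl u x 2) (WithLp.toLp 2 ![y 0, y 1, c]) * (curl u (WithLp.toLp 2 ![y 0, y 1, c]) 1 * u (WithLp.toLp 2 ![y 0, y 1, c]) 2)) := by
    calc (∫ y : EuclideanSpace ℝ (Fin 2), u (WithLp.toLp 2 ![y 0, y 1, c]) 2 * (ε ^ 2 / Real.sqrt ((curl u (WithLp.toLp 2 ![y 0, y 1, c]) 2) ^ 2 + ε ^ 2) ^ 3) * (curl u (WithLp.toLp 2 ![y 0, y 1, c]) 0 * pderiv 0 (fun x => curl u x 2) (WithLp.toLp 2 ![y 0, y 1, c]) + curl u (WithLp.toLp 2 ![y 0, y 1, c]) 1 * pderiv 1 (fun x => curl u x 2) (WithLp.toLp 2 ![y 0, y 1, c]))) = ∫ y : EuclideanSpace ℝ (Fin 2), (ε ^ 2 / Real.sqrt ((curl u (WithLp.toLp 2 ![y 0, y 1, c]) 2) ^ 2 + ε ^ 2) ^ 3 * pderiv 0 (fun x => curl u x 2) (WithLp.toLp 2 ![y 0, y 1,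 c]) * (curl u (WithLp.toLp 2 ![y 0, y 1, c]) 0 * u (WithLp.toLp 2 ![y 0, y 1, c]) 2) + ε ^ 2 / Real.sqrt ((curl u (WithLp.toLp 2 ![y 0, y 1, c]) 2) ^ 2 + ε ^ 2) ^ 3 * pderiv 1 (fun x => curl u x 2) (WithLp.toLp 2 ![y 0, y 1, c]) * (curl u (WithLp.toLp 2 ![y 0, y 1, c]) 1 * u (WithLp.toLp 2 ![y 0, y 1, c]) 2)) := by
          congr 1; funext y; ring
      _ = _ := integral_add (I10 0) (I10 1)
  -- (D) incompressibility: `∂₀u₀ + ∂₁u₁ = −∂₂u₂`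
  have hD1 : (∫ y : EuclideanSpace ℝ (Fin 2), curl u (WithLp.toLp 2 ![y 0, y 1, c]) 2 / Real.sqrt ((curl u (WithLp.toLp 2 ![y 0, y 1, c]) 2) ^ 2 + ε ^ 2) * curl u (WithLp.toLp 2 ![y 0, y 1, c]) 2 * pderiv 0 (fun x => u x 0) (WithLp.toLp 2 ![y 0, y 1, c])) + (∫ y : EuclideanSpace ℝ (Fin 2), curl u (WithLp.toLp 2 ![y 0, y 1, c]) 2 / Real.sqrt ((curl u (WithLp.toLp 2 ![y 0, y 1, c]) 2) ^ 2 + ε ^ 2) * curl u (WithLp.toLp 2 ![y 0, y 1, c]) 2 * pderiv 1 (fun x => u x 1) (WithLp.toLp 2 ![y 0, y 1, c])) = - (∫ y : EuclideanSpace ℝ (Fin 2), curl u (WithLp.toLp 2 ![y 0, y 1, c]) 2 / Real.sqrt ((curl u (WithLp.toLp 2 ![y 0, y 1, c]) 2) ^ 2 + ε ^ 2) * curl u (WithLp.toLp 2 ![y 0, y 1, c]) 2 * pderiv 2 (fun x => u x 2) (WithLp.toLp 2 ![y 0, y 1, c])) := by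
    rw [← integral_add (I14 0) (I14 1), ← integral_neg]
    congr 1; funext y
    have h := sum_pderiv_eq_zero hu hdiv (WithLp.toLp 2 ![y 0, y 1, c])
    linear_combination (curl u (WithLp.toLp 2 ![y 0, y 1, c]) 2 / Real.sqrt ((curl u (WithLp.toLp 2 ![y 0, y 1, c]) 2) ^ 2 + ε ^ 2) * curl u (WithLp.toLp 2 ![y 0, y 1, c]) 2) * h
  have hD2 : (∫ y : EuclideanSpace ℝ (Fin 2), pderiv 0 (fun x => u x 0) (WithLp.toLp 2 ![y 0, y 1, c]) * Real.sqrt ((curl u (WithLp.toLp 2 ![y 0, y 1, c]) 2) ^ 2 + ε ^ 2)) + (∫ y : EuclideanSpace ℝ (Fin 2), pderiv 1 (fun x => u x 1) (WithLp.toLp 2 ![y 0, y 1, c]) * Real.sqrt ((curl u (WithLp.toLp 2 ![y 0, y 1, c]) 2) ^ 2 + ε ^ 2)) = - (∫ y : EuclideanSpace ℝ (Fin 2), pderiv 2 (fun x => u x 2) (WithLp.toLp 2 ![y 0, y 1, c]) * Real.sqrt ((curl u (WithLp.toLp 2 ![y 0, y 1, c]) 2) ^ 2 + ε ^ 2)) :=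 by
    rw [← integral_add (I6 0) (I6 1), ← integral_neg]
    congr 1; funext y
    have h := sum_pderiv_eq_zero hu hdiv (WithLp.toLp 2 ![y 0, y 1, c])
    linear_combination (Real.sqrt ((curl u (WithLp.toLp 2 ![y 0, y 1, c]) 2) ^ 2 + ε ^ 2)) * h
  -- (E) `f F'(f) − F(f) = −ε²/F(f)`
  have hE : (∫ y : EuclideanSpace ℝ (Fin 2), curl u (WithLp.toLp 2 ![y 0, y 1, c]) 2 / Real.sqrt ((curl u (WithLp.toLp 2 ![y 0, y 1, c]) 2) ^ 2 + ε ^ 2) * curl u (WithLp.toLp 2 ![y 0, y 1, c]) 2 * pderiv 2 (fun x => u x 2) (WithLp.toLp 2 ![y 0, y 1, c])) - (∫ y : EuclideanSpace ℝ (Fin 2), pderiv 2 (fun x => u x 2) (WithLp.toLp 2 ![y 0, y 1, c]) * Real.sqrt ((curl u (WithLp.toLp 2 ![y 0, y 1, c]) 2) ^ 2 + ε ^ 2)) = - (ε ^ 2 * (∫ y : EuclideanSpace ℝ (Fin 2), pderiv 2 (fun x => u x 2) (WithLp.toLp 2 ![y 0, y 1, c]) / Real.sqrt ((curl u (WithLp.toLp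 2 ![y 0, y 1, c]) 2) ^ 2 + ε ^ 2))) := by
    rw [← integral_sub (I14 2) (I6 2), ← integral_const_mul, ← integral_neg]
    congr 1; funext y
    have hFp : 0 < Real.sqrt ((curl u (WithLp.toLp 2 ![y 0, y 1, c]) 2) ^ 2 + ε ^ 2) := PassiveScalarL1.sqrt_sq_add_sq_pos hε _
    have hsq : Real.sqrt ((curl u (WithLp.toLp 2 ![y 0, y 1, c]) 2) ^ 2 + ε ^ 2) ^ 2 = (curl u (WithLp.toLp 2 ![y 0, y 1, c]) 2) ^ 2 + ε ^ 2 := Real.sq_sqrt (by positivity)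
    field_simp
    linear_combination (-(pderiv 2 (fun x => u x 2) (WithLp.toLp 2 ![y 0, y 1, c]))) * hsq
  linear_combination hL + ν * hA0 + ν * hA1 - hB0 - hB1 + hC0 + hC1 - ν * hT1 + ν * hT2 + hT3 - hD1 + hD2 + hE

end FoldLaw

open FoldLaw in
/-- **Item stmt-NavierStokesRegularity-15606** (`SlicedKelvin.FoldLawEps`): the ε-regularised fold
law on the coordinate plane `{x₂ = c}` for smooth rapidly decaying divergence-free fields.
[folklore] -/
theorem slicedKelvin_foldLawEps_proof :
    Summit.NavierStokesRegularity.NavierStokesRegularity.Theses.SlicedKelvin.FoldLawEps := by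
  unfold Summit.NavierStokesRegularity.NavierStokesRegularity.Theses.SlicedKelvin.FoldLawEps
  intro ν ε c hε u hu hdec hdiv
  exact foldLaw_identity ν c hε hu hdec hdiv

end Summit.NavierStokesRegularity.NavierStokesRegularity.Theorems

end
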